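import Summits.QuantumFields.BalabanUV.Beta.GAN24.DerivativeRateTransferStraighten

/-!
# `BalabanUV.Beta.GAN24.DerivativeRateTransferStraightenJet` — binder row G-an2-4 ∕ (CONV-C), route R6 «VALUES, NOT DERIVATIVES», PART 39:
# THE STRAIGHTENED FINE FORM TO FIRST ORDER, EXACTLY — with `W = 1 + z₁ℋQ₁ + z₂ℋQ₂` (`ℋ = ℋ(H,Q)`) and the FIRST-ORDER JETS
# `K_i := H_i − Q_iᵀ𝒮Q − Qᵀ𝒮Q_i` (`𝒮 = 𝒮(H,Q)`): `Wᵀ·(H + z₁K₁ + z₂K₂)·W = (H + z₁H₁ + z₂H₂) + E(z)` with the remainder `E(z)` an explicit polynomial of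
# order ≥ 2 in `z`, hence `W⁻ᵀ·(H + z₁H₁ + z₂H₂)·W⁻¹ = (H + z₁K₁ + z₂K₂) − W⁻ᵀE(z)W⁻¹` — the letter whose real part ∕ sector PART 38 §3 displays
# (unit b2b-balaban-gan24-p3, gen 39; gan24-idea-1 g47's scope note «K_W := H₁ − Q₁ᵀ𝒮Q − Qᵀ𝒮Q₁», typed with the exact remainder; any field)

NOT IN PRINT; OUR PROOF (for the ROUTE; [folklore] ring algebra over a field — an2's Euler–Lagrange `Hℋ = Qᵀ𝒮` (`mul_minOp_eq`), value identity `ℋᵀHℋ = 𝒮`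
(`transpose_minOp_mul_mul_minOp`) and `𝒮ᵀ = 𝒮` for symmetric `H` (`minOpL_eq_transpose`) BY NAME; §4 also an1's `BorderedJets.dEffForm_eq_of_symm`).  HONEST FRAMING (cell contract, verbatim): «discharging `BetaPertH`
makes Bałaban's UV stability UNCONDITIONAL — a real constructive-QFT result; it is NOT the continuum limit and NOT the Clay problem.»  HONEST DEPENDENCY (verbatim):
«continuum YM on T⁴ ⇐ BetaPertH ∧ nine spine estimates (0/9 proved); BetaPertH ⇐ (D1) ∧ (D4) ∧ CAP+tail; G-an2-4 gates asym, D1 and NE2/3/4.»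

WHY THIS FILE.  PART 38 §3 reduces S2 for a family WITH constraint jets at a point `z` to: `W(z)` invertible + the accretive REAL letters of the straightened form
`M_W(z) := W(z)⁻ᵀ·(H + z₁H₁ + z₂H₂)·W(z)⁻¹` (PSD of `Re M_W`, real nonsingularity, sector for `Im M_W`, row bound) — and displays them.  What ARE they to first
order?  With `N_i := ℋQ_i` and `R := z₁N₁ + z₂N₂` one has `RᵀH = (z₁Q₁ + z₂Q₂)ᵀ𝒮Q`, `HR = Qᵀ𝒮(z₁Q₁ + z₂Q₂)`, `RᵀHR = (z₁Q₁ + z₂Q₂)ᵀ𝒮(z₁Q₁ + z₂Q₂)` (§1), so the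
unique first-order correction `K` with `K + RᵀH + HR = z₁H₁ + z₂H₂` is `K = z₁K₁ + z₂K₂`, `K_i = H_i − Q_iᵀ𝒮Q − Qᵀ𝒮Q_i` — gan24-idea-1 g47's `K_W` — and
`(1+R)ᵀ(H + K)(1+R) = H + z₁H₁ + z₂H₂ + E`, `E = RᵀK + KR + RᵀHR + RᵀKR` (§2, exact).  CONSEQUENCE (§3): `M_W(z) = H + z₁K₁ + z₂K₂ − W⁻ᵀEW⁻¹`; at a complex
point the REAL PART to first order is `H + (Re z₁)K₁ + (Re z₂)K₂` — NOT the real family member `H + (Re z₁)H₁ + (Re z₂)H₂`: the block-averaged symmetric terms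
`Q_iᵀ𝒮Q + Qᵀ𝒮Q_i` enter the PSD letter at first order in `Re z` as well as the sector letter at first order in `Im z`.  This is the object the desk's K-ACC-2 and
lens 1's cell P-47-1 (`κ_W(j) = ‖S_a^{−1∕2}K_W S_a^{−1∕2}‖`) price; nothing here bounds it.

WHAT THIS FILE PROVES (0 sorry, 0 `def`, nothing cited; any field `𝕜`, `H` symmetric, `kkt(H,Q)` nonsingular):
* §1 `transpose_mul_self_eq` (`(ℋQ₁)ᵀH = Q₁ᵀ𝒮Q`), `self_mul_eq` (`H(ℋQ₁) = Qᵀ𝒮Q₁`), `sandwich_eq` (`(ℋQ₁)ᵀH(ℋQ₂) = Q₁ᵀ𝒮Q₂`), **`jet_first_order`**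
  (`(z₁K₁ + z₂K₂) + RᵀH + HR = z₁H₁ + z₂H₂`).
* §2 `conj_one_add_expand` (the ring identity `(1+R)ᵀ(H+K)(1+R) = H + (K + RᵀH + HR) + (RᵀK + KR + RᵀHR + RᵀKR)`), **`straighten_jet_identity`**
  (`Wᵀ(H + z₁K₁ + z₂K₂)W = (H + z₁H₁ + z₂H₂) + E(z)`), `remainder_sandwich` (`RᵀHR = (z₁Q₁ + z₂Q₂)ᵀ𝒮(z₁Q₁ + z₂Q₂)`).
* §3 **`straightened_form_eq`** (`W` invertible ⟹ `W⁻ᵀ(H + z₁H₁ + z₂H₂)W⁻¹ = (H + z₁K₁ + z₂K₂) − W⁻ᵀE(z)W⁻¹`).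
* §4 **`dEffForm_eq_jet_sandwich`** (`d𝒮 = ℋᵀ·K₁·ℋ`: an1's first B-jet row `dEffForm H Q H₁ Q₁` IS the `K`-jet evaluated on the minimiser — an1's
  `BorderedJets.dEffForm_eq_of_symm` + `Qℋ = 1` BY NAME; gan24-idea-1 g47's lens item 4 «HF-1» letter `E₁ = ℋᵀK_Wℋ`).
WHAT IT DOES NOT DO: bound `E(z)`, `W(z)⁻¹`, or the sector of `K_i` for any of Bałaban's operators (the instance letters n_Q, κ_W); S2(ii).  SUPPLIER work on route R6
(rank 2, REDUCTION, no seat); no consumer of record; NEVER «G-an2-4 closed»; NOT (CONV-C), NOT D1, NOT `BetaPertH`, NOT continuum, NOT Clay.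
Records: `HOME/b2b-balaban-gan24-p3/WOODBURY-FIBRE.md` v13.9.
-/

noncomputable section

open Matrix

namespace Summit.QuantumFields.BalabanUV.Beta.GAN24.DerivativeRateTransferStraightenJet

open Literature.MathematicalPhysics.QuantumFieldTheory.Balaban1983to89.Beta.Composition (kkt)
open Literature.MathematicalPhysics.QuantumFieldTheory.Balaban1983to89.Beta.CompositionSingular (effForm minOp mul_minOp mul_minOp_eq transpose_minOp_mul_mul_minOp
  minOpL_eq_transpose)
open Literature.MathematicalPhysics.QuantumFieldTheory.Balaban1983to89.Beta.BorderedJets (dEffForm dEffForm_eq_of_symm)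

variable {𝕜 : Type*} [Field 𝕜]
variable {ν μ : Type*} [Fintype ν] [Fintype μ] [DecidableEq ν] [DecidableEq μ]
variable {H H₁ H₂ : Matrix ν ν 𝕜} {Q Q₁ Q₂ : Matrix μ ν 𝕜}

/-! ## §1 The straightening directions against the fine form: everything is block-averaged -/

/-- [folklore] `(ℋQ₁)ᵀ·H = Q₁ᵀ·𝒮·Q` for symmetric `H` (Euler–Lagrange transposed). -/
theorem transpose_mul_self_eq (hH : Hᵀ = H) (h : IsUnit (kkt H Q).det) (Q₁ : Matrix μ ν 𝕜) :
    (minOp H Q * Q₁)ᵀ * H = Q₁ᵀ * effForm H Q * Q := by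
  have hS : (effForm H Q)ᵀ = effForm H Q := (minOpL_eq_transpose H Q hH).2.2
  have e : (minOp H Q)ᵀ * H = effForm H Q * Q := by
    have := congrArg Matrix.transpose (mul_minOp_eq H Q h)
    rwa [Matrix.transpose_mul, Matrix.transpose_mul, Matrix.transpose_transpose, hH, hS] at this
  rw [Matrix.transpose_mul, Matrix.mul_assoc, e, Matrix.mul_assoc]

/-- [folklore] `H·(ℋQ₁) = Qᵀ·𝒮·Q₁` (Euler–Lagrange). -/
theorem self_mul_eq (h : IsUnit (kkt H Q).det) (Q₁ : Matrix μ ν 𝕜) : H * (minOp H Q * Q₁) = Qᵀ * effForm H Q * Q₁ := by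
  rw [← Matrix.mul_assoc, mul_minOp_eq H Q h]

/-- [folklore] `(ℋQ₁)ᵀ·H·(ℋQ₂) = Q₁ᵀ·𝒮·Q₂` (the value identity `ℋᵀHℋ = 𝒮`). -/
theorem sandwich_eq (h : IsUnit (kkt H Q).det) (Q₁ Q₂ : Matrix μ ν 𝕜) :
    (minOp H Q * Q₁)ᵀ * H * (minOp H Q * Q₂) = Q₁ᵀ * effForm H Q * Q₂ := by
  rw [Matrix.transpose_mul, Matrix.mul_assoc, Matrix.mul_assoc, ← Matrix.mul_assoc H, ← Matrix.mul_assoc (minOp H Q)ᵀ,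
    ← Matrix.mul_assoc (minOp H Q)ᵀ, transpose_minOp_mul_mul_minOp H Q h, Matrix.mul_assoc]

/-- **`jet_first_order` — THE FIRST-ORDER JET OF THE STRAIGHTENED FORM** [our proof; gan24-idea-1 g47's `K_W`]: with `R = z₁ℋQ₁ + z₂ℋQ₂` and
`K_i = H_i − Q_iᵀ𝒮Q − Qᵀ𝒮Q_i`: `(z₁K₁ + z₂K₂) + RᵀH + HR = z₁H₁ + z₂H₂`. -/
theorem jet_first_order (hH : Hᵀ = H) (h : IsUnit (kkt H Q).det) (z₁ z₂ : 𝕜) :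
    (z₁ • (H₁ - (Q₁ᵀ * effForm H Q * Q + Qᵀ * effForm H Q * Q₁)) + z₂ • (H₂ - (Q₂ᵀ * effForm H Q * Q + Qᵀ * effForm H Q * Q₂)))
      + (z₁ • (minOp H Q * Q₁) + z₂ • (minOp H Q * Q₂))ᵀ * H + H * (z₁ • (minOp H Q * Q₁) + z₂ • (minOp H Q * Q₂)) = z₁ • H₁ + z₂ • H₂ := by
  rw [Matrix.transpose_add, Matrix.transpose_smul, Matrix.transpose_smul, Matrix.add_mul, Matrix.smul_mul, Matrix.smul_mul,
    transpose_mul_self_eq hH h, transpose_mul_self_eq hH h, Matrix.mul_add, Matrix.mul_smul, Matrix.mul_smul, self_mul_eq h, self_mul_eq h]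
  module

/-! ## §2 The conjugation identity and the exact remainder -/

omit [Fintype μ] [DecidableEq μ] in
/-- [folklore] the ring identity `(1+R)ᵀ(H+K)(1+R) = H + (K + RᵀH + HR) + (RᵀK + KR + RᵀHR + RᵀKR)`. -/
theorem conj_one_add_expand (H K R : Matrix ν ν 𝕜) :
    (1 + R)ᵀ * (H + K) * (1 + R) = H + (K + Rᵀ * H + H * R) + (Rᵀ * K + K * R + Rᵀ * H * R + Rᵀ * K * R) := by
  rw [Matrix.transpose_add, Matrix.transpose_one]
  noncomm_ring

/-- [folklore] `RᵀHR = (z₁Q₁ + z₂Q₂)ᵀ·𝒮·(z₁Q₁ + z₂Q₂)` for `R = z₁ℋQ₁ + z₂ℋQ₂`. -/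
theorem remainder_sandwich (h : IsUnit (kkt H Q).det) (z₁ z₂ : 𝕜) :
    (z₁ • (minOp H Q * Q₁) + z₂ • (minOp H Q * Q₂))ᵀ * H * (z₁ • (minOp H Q * Q₁) + z₂ • (minOp H Q * Q₂)) =
      (z₁ • Q₁ + z₂ • Q₂)ᵀ * effForm H Q * (z₁ • Q₁ + z₂ • Q₂) := by
  have e : z₁ • (minOp H Q * Q₁) + z₂ • (minOp H Q * Q₂) = minOp H Q * (z₁ • Q₁ + z₂ • Q₂) := by
    rw [Matrix.mul_add, Matrix.mul_smul, Matrix.mul_smul]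
  rw [e, Matrix.transpose_mul, Matrix.mul_assoc, Matrix.mul_assoc, ← Matrix.mul_assoc H, ← Matrix.mul_assoc (minOp H Q)ᵀ,
    ← Matrix.mul_assoc (minOp H Q)ᵀ, transpose_minOp_mul_mul_minOp H Q h, Matrix.mul_assoc]

/-- **`straighten_jet_identity` — THE STRAIGHTENING TO FIRST ORDER, EXACTLY** [our proof]: `W = 1 + z₁ℋQ₁ + z₂ℋQ₂`, `K = z₁K₁ + z₂K₂` ⟹
`Wᵀ·(H + K)·W = (H + z₁H₁ + z₂H₂) + (RᵀK + KR + RᵀHR + RᵀKR)`, `R = W − 1`. -/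
theorem straighten_jet_identity (hH : Hᵀ = H) (h : IsUnit (kkt H Q).det) (z₁ z₂ : 𝕜) :
    (1 + (z₁ • (minOp H Q * Q₁) + z₂ • (minOp H Q * Q₂)))ᵀ *
        (H + (z₁ • (H₁ - (Q₁ᵀ * effForm H Q * Q + Qᵀ * effForm H Q * Q₁)) + z₂ • (H₂ - (Q₂ᵀ * effForm H Q * Q + Qᵀ * effForm H Q * Q₂)))) *
        (1 + (z₁ • (minOp H Q * Q₁) + z₂ • (minOp H Q * Q₂))) =
      (H + z₁ • H₁ + z₂ • H₂) +
        ((z₁ • (minOp H Q * Q₁) + z₂ • (minOp H Q * Q₂))ᵀ *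
              (z₁ • (H₁ - (Q₁ᵀ * effForm H Q * Q + Qᵀ * effForm H Q * Q₁)) + z₂ • (H₂ - (Q₂ᵀ * effForm H Q * Q + Qᵀ * effForm H Q * Q₂))) +
            (z₁ • (H₁ - (Q₁ᵀ * effForm H Q * Q + Qᵀ * effForm H Q * Q₁)) + z₂ • (H₂ - (Q₂ᵀ * effForm H Q * Q + Qᵀ * effForm H Q * Q₂))) *
              (z₁ • (minOp H Q * Q₁) + z₂ • (minOp H Q * Q₂)) +
            (z₁ • (minOp H Q * Q₁) + z₂ • (minOp H Q * Q₂))ᵀ * H * (z₁ • (minOp H Q * Q₁) + z₂ • (minOp H Q * Q₂)) +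
          (z₁ • (minOp H Q * Q₁) + z₂ • (minOp H Q * Q₂))ᵀ *
              (z₁ • (H₁ - (Q₁ᵀ * effForm H Q * Q + Qᵀ * effForm H Q * Q₁)) + z₂ • (H₂ - (Q₂ᵀ * effForm H Q * Q + Qᵀ * effForm H Q * Q₂))) *
            (z₁ • (minOp H Q * Q₁) + z₂ • (minOp H Q * Q₂))) := by
  rw [conj_one_add_expand, jet_first_order hH h, ← add_assoc H (z₁ • H₁) (z₂ • H₂)]

/-! ## §3 The straightened fine form = its first-order part minus the conjugated remainder -/

/-- **`straightened_form_eq`** [our proof]: for `W = 1 + z₁ℋQ₁ + z₂ℋQ₂` invertible and `E` the exact remainder of `straighten_jet_identity`: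
`W⁻ᵀ·(H + z₁H₁ + z₂H₂)·W⁻¹ = (H + z₁K₁ + z₂K₂) − W⁻ᵀ·E·W⁻¹` — the fine form of PART 38 §3's straightened datum, to first order the `K`-jets. -/
theorem straightened_form_eq (hH : Hᵀ = H) (h : IsUnit (kkt H Q).det) (z₁ z₂ : 𝕜)
    (hW : IsUnit (1 + (z₁ • (minOp H Q * Q₁) + z₂ • (minOp H Q * Q₂))).det) :
    (1 + (z₁ • (minOp H Q * Q₁) + z₂ • (minOp H Q * Q₂)))⁻¹ᵀ * (H + z₁ • H₁ + z₂ • H₂) * (1 + (z₁ • (minOp H Q * Q₁) + z₂ • (minOp H Q * Q₂)))⁻¹ =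
      (H + (z₁ • (H₁ - (Q₁ᵀ * effForm H Q * Q + Qᵀ * effForm H Q * Q₁)) + z₂ • (H₂ - (Q₂ᵀ * effForm H Q * Q + Qᵀ * effForm H Q * Q₂)))) -
        (1 + (z₁ • (minOp H Q * Q₁) + z₂ • (minOp H Q * Q₂)))⁻¹ᵀ *
            ((z₁ • (minOp H Q * Q₁) + z₂ • (minOp H Q * Q₂))ᵀ *
                  (z₁ • (H₁ - (Q₁ᵀ * effForm H Q * Q + Qᵀ * effForm H Q * Q₁)) + z₂ • (H₂ - (Q₂ᵀ * effForm H Q * Q + Qᵀ * effForm H Q * Q₂))) +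
                (z₁ • (H₁ - (Q₁ᵀ * effForm H Q * Q + Qᵀ * effForm H Q * Q₁)) + z₂ • (H₂ - (Q₂ᵀ * effForm H Q * Q + Qᵀ * effForm H Q * Q₂))) *
                  (z₁ • (minOp H Q * Q₁) + z₂ • (minOp H Q * Q₂)) +
                (z₁ • (minOp H Q * Q₁) + z₂ • (minOp H Q * Q₂))ᵀ * H * (z₁ • (minOp H Q * Q₁) + z₂ • (minOp H Q * Q₂)) +
              (z₁ • (minOp H Q * Q₁) + z₂ • (minOp H Q * Q₂))ᵀ *
                  (z₁ • (H₁ - (Q₁ᵀ * effForm H Q * Q + Qᵀ * effForm H Q * Q₁)) + z₂ • (H₂ - (Q₂ᵀ * effForm H Q * Q + Qᵀ * effForm H Q * Q₂))) *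
                (z₁ • (minOp H Q * Q₁) + z₂ • (minOp H Q * Q₂))) *
          (1 + (z₁ • (minOp H Q * Q₁) + z₂ • (minOp H Q * Q₂)))⁻¹ := by
  set W := 1 + (z₁ • (minOp H Q * Q₁) + z₂ • (minOp H Q * Q₂)) with hWdef
  set X := H + (z₁ • (H₁ - (Q₁ᵀ * effForm H Q * Q + Qᵀ * effForm H Q * Q₁)) + z₂ • (H₂ - (Q₂ᵀ * effForm H Q * Q + Qᵀ * effForm H Q * Q₂)))
  have hid := straighten_jet_identity (H₁ := H₁) (H₂ := H₂) (Q₁ := Q₁) (Q₂ := Q₂) hH h z₁ z₂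
  rw [← hWdef] at hid
  -- `H + z₁H₁ + z₂H₂ = WᵀXW − E`
  have hWt : IsUnit Wᵀ.det := by rwa [Matrix.det_transpose]
  have e1 : W⁻¹ᵀ * Wᵀ = 1 := by rw [← Matrix.transpose_mul, Matrix.mul_nonsing_inv _ hW, Matrix.transpose_one]
  have e2 : W * W⁻¹ = 1 := Matrix.mul_nonsing_inv _ hW
  have key : ∀ E : Matrix ν ν 𝕜, Wᵀ * X * W = (H + z₁ • H₁ + z₂ • H₂) + E →
      W⁻¹ᵀ * (H + z₁ • H₁ + z₂ • H₂) * W⁻¹ = X - W⁻¹ᵀ * E * W⁻¹ := by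
    intro E hE
    have hE' : H + z₁ • H₁ + z₂ • H₂ = Wᵀ * X * W - E := by rw [hE, add_sub_cancel_right]
    rw [hE', Matrix.mul_sub, Matrix.sub_mul]
    congr 1
    calc W⁻¹ᵀ * (Wᵀ * X * W) * W⁻¹ = (W⁻¹ᵀ * Wᵀ) * X * (W * W⁻¹) := by simp only [Matrix.mul_assoc]
      _ = X := by rw [e1, e2, Matrix.one_mul, Matrix.mul_one]
  exact key _ hid

/-! ## §4 The first `B`-jet row is the `K`-jet on the minimiser -/

/-- **`dEffForm_eq_jet_sandwich` — an1's FIRST B-JET ROW IS THE `K`-JET EVALUATED ON THE MINIMISER** [our proof; an1's `BorderedJets.dEffForm_eq_of_symm`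
(`d𝒮 = ℋᵀδHℋ − 𝒮δQℋ − ℋᵀδQᵀ𝒮`) + `Qℋ = 1` BY NAME]: `dEffForm H Q H₁ Q₁ = ℋᵀ·(H₁ − (Q₁ᵀ𝒮Q + Qᵀ𝒮Q₁))·ℋ` — the same letter `K₁` governs the complex
road (PART 38 §3 ∕ §3 here: the straightened fine form) and the real road (gan24-idea-1 g47's lens item 4 «HF-1»: `E₁ = ℋᵀK_Wℋ`). -/
theorem dEffForm_eq_jet_sandwich (hH : Hᵀ = H) (h : IsUnit (kkt H Q).det) (H₁ : Matrix ν ν 𝕜) (Q₁ : Matrix μ ν 𝕜) :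
    dEffForm H Q H₁ Q₁ = (minOp H Q)ᵀ * (H₁ - (Q₁ᵀ * effForm H Q * Q + Qᵀ * effForm H Q * Q₁)) * minOp H Q := by
  have hQm : Q * minOp H Q = 1 := mul_minOp H Q h
  have hmQ : (minOp H Q)ᵀ * Qᵀ = 1 := by rw [← Matrix.transpose_mul, hQm, Matrix.transpose_one]
  rw [dEffForm_eq_of_symm H H₁ Q Q₁ hH, Matrix.mul_sub, Matrix.sub_mul, Matrix.mul_add, Matrix.add_mul]
  have e1 : (minOp H Q)ᵀ * (Q₁ᵀ * effForm H Q * Q) * minOp H Q = (minOp H Q)ᵀ * Q₁ᵀ * effForm H Q := by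
    rw [Matrix.mul_assoc, Matrix.mul_assoc, Matrix.mul_assoc, hQm, Matrix.mul_one, ← Matrix.mul_assoc]
  have e2 : (minOp H Q)ᵀ * (Qᵀ * effForm H Q * Q₁) * minOp H Q = effForm H Q * Q₁ * minOp H Q := by
    rw [← Matrix.mul_assoc, ← Matrix.mul_assoc, hmQ, Matrix.one_mul]
  rw [e1, e2]
  abel

end Summit.QuantumFields.BalabanUV.Beta.GAN24.DerivativeRateTransferStraightenJet

end
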